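import Mathlib
import HarnessLib
import Literature.AlgebraicGeometry.HyperbolicPolynomials.SpectrahedralShadow
import Summits.ValiantsHypothesis.ValiantsHypothesis.Theorems.PermanentalConesHyperbolicVPShadowStubSpectrahedronOfSymmDetIdentity
import Summits.ValiantsHypothesis.ValiantsHypothesis.Theorems.PermanentalConesHyperbolicVPShadowStubOshimeFamilyThSpectrahedron

/-!
# ValiantsHypothesis / PermanentalCones — `HyperbolicVPShadow`, stub T≤

Route `PermanentalCones`, item `stmt-ValiantsHypothesis-8655` (crux `HyperbolicVPShadow`), line
`birth`, stub `stub_oshimeFamilyTle_spectrahedron`: Oshime's Jordan-block family (T) of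
real-spectrum `3 × 3` pencils (J. Math. Kyoto Univ. 31 (1991), part (II), Prop. 4.6 / Thm. 6.2),
homogenised, has size-`3` spectrahedral cones — now with *coincident roots allowed*, i.e. under
the printed non-strict hypotheses `s₁ ≤ s₂ ≤ s₃`, `s₁ ≤ b₁ ≤ s₂ ≤ b₂ ≤ s₃`.

The pencil is `P x = x₀·1 + x₁ J₃ + x₂ B + x₃ C` with `J₃ = E₁₂ + E₂₃`,
`B = !![0, e₂, −e₃; −1, e₁, 0; 0, 1, 0]` (`eᵢ` the elementary symmetric functions of
`s₁, s₂, s₃`) and `C = b₀ · !![0, b₁ + b₂, −b₁ b₂; 0, 1, 0; 0, 0, 0]`.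

## Proof

* `permanentalCones_oshimeTle_of_lagrange` (the common tail): whenever reals `c₁, c₂, c₃`
  satisfy the Lagrange-type identity
  `(L)  ∑ᵢ cᵢ² ∏_{j ≠ i} (t + sⱼ y) = (t + b₁ y)(t + b₂ y)` for all `t, y`,
  the real symmetric "diagonal + rank one" certificate
  `L x = x₀·1 + x₂ diag (s₁, s₂, s₃) + x₃ b₀ c cᵀ` has `det (P x + τ·1) = det (L x + τ·1)`
  (`permanentalCones_oshimeT_detP`, `permanentalCones_oshimeT_detL` of the strict file), and
  `stub_spectrahedron_of_symmDetIdentity` (stub S) gives a size-`3` spectrahedral description.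
* `stub_oshimeFamilyTle_spectrahedron`: case analysis on which roots coincide.
  - `s₁ < s₂ < s₃`: the landed strict theorem `stub_oshimeFamilyTh_spectrahedron`;
  - `s₁ = s₂ < s₃` (so `b₁ = s₁`): `κ = ((b₂ − s₁)/(s₃ − s₁), 0, (s₃ − b₂)/(s₃ − s₁))`;
  - `s₁ < s₂ = s₃` (so `b₂ = s₂`): `κ = ((b₁ − s₁)/(s₂ − s₁), (s₂ − b₁)/(s₂ − s₁), 0)`;
  - `s₁ = s₂ = s₃` (so `b₁ = b₂ = s₁`): `κ = (1, 0, 0)`;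
  in each case `κᵢ ≥ 0` by interlacing, `cᵢ = √κᵢ`, and (L) is a polynomial identity.
-/

-- `<Problem> = <Summit>` for this single-conjunct summit (lakefile sets the same option tree-wide).
set_option linter.dupNamespace false

namespace Summit.ValiantsHypothesis.ValiantsHypothesis.Theorems

open Matrix

/-! ## The common tail: a Lagrange-type identity gives the spectrahedral description -/

/-- **Tail (Lagrange identity ⇒ size-`3` spectrahedral cone).** If `c₁, c₂, c₃ : ℝ` satisfy
`∑ᵢ cᵢ² ∏_{j ≠ i} (t + sⱼ y) = (t + b₁ y)(t + b₂ y)` identically in `t, y`, then the closed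
nonnegative-spectrum cone of Oshime's family (T) pencil `x₀·1 + x₁ J₃ + x₂ B + x₃ C` is a
spectrahedron of size `3`, certified by the real symmetric pencil
`L x = x₀·1 + x₂ diag (s₁, s₂, s₃) + x₃ b₀ c cᵀ`: `det (P x + τ·1) = det (L x + τ·1)` and
stub S applies. No distinctness of the `sᵢ` is needed here. [folklore] -/
theorem permanentalCones_oshimeTle_of_lagrange (s₁ s₂ s₃ b₀ b₁ b₂ c₁ c₂ c₃ : ℝ)
    (hlag : ∀ t y : ℝ,
      c₁ ^ 2 * ((t + s₂ * y) * (t + s₃ * y)) + c₂ ^ 2 * ((t + s₁ * y) * (t + s₃ * y)) +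
          c₃ ^ 2 * ((t + s₁ * y) * (t + s₂ * y)) =
        (t + b₁ * y) * (t + b₂ * y)) :
    Literature.AlgebraicGeometry.HyperbolicPolynomials.IsSpectrahedralShadowOfSize
      {x : Fin 4 → ℝ | ∀ τ : ℝ, 0 < τ →
        (x 0 • (1 : Matrix (Fin 3) (Fin 3) ℝ) + x 1 • !![(0 : ℝ), 1, 0; 0, 0, 1; 0, 0, 0] +
          x 2 • !![0, s₁ * s₂ + s₂ * s₃ + s₃ * s₁, -(s₁ * s₂ * s₃); -1, s₁ + s₂ + s₃, 0; 0, 1, 0] +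
          x 3 • !![0, b₀ * (b₁ + b₂), -(b₀ * b₁ * b₂); 0, b₀, 0; 0, 0, 0] +
          τ • (1 : Matrix (Fin 3) (Fin 3) ℝ)).det ≠ 0} 3 := by
  -- the pencil `P x = x 0 • 1 + x 1 • J₃ + x 2 • B + x 3 • C`
  let P : (Fin 4 → ℝ) →ₗ[ℝ] Matrix (Fin 3) (Fin 3) ℝ := Fintype.linearCombination ℝ
    ![(1 : Matrix (Fin 3) (Fin 3) ℝ), !![(0 : ℝ), 1, 0; 0, 0, 1; 0, 0, 0],
      !![0, s₁ * s₂ + s₂ * s₃ + s₃ * s₁, -(s₁ * s₂ * s₃); -1, s₁ + s₂ + s₃, 0; 0, 1, 0],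
      !![0, b₀ * (b₁ + b₂), -(b₀ * b₁ * b₂); 0, b₀, 0; 0, 0, 0]]
  have hP : ∀ x : Fin 4 → ℝ, P x =
      x 0 • (1 : Matrix (Fin 3) (Fin 3) ℝ) + x 1 • !![(0 : ℝ), 1, 0; 0, 0, 1; 0, 0, 0] +
        x 2 • !![0, s₁ * s₂ + s₂ * s₃ + s₃ * s₁, -(s₁ * s₂ * s₃); -1, s₁ + s₂ + s₃, 0; 0, 1, 0] +
        x 3 • !![0, b₀ * (b₁ + b₂), -(b₀ * b₁ * b₂); 0, b₀, 0; 0, 0, 0] := fun x => by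
    simp only [P, Fintype.linearCombination_apply, Fin.sum_univ_four, Matrix.cons_val_zero,
      Matrix.cons_val_one, Matrix.cons_val_two, Matrix.cons_val_three, Matrix.head_cons,
      Matrix.tail_cons]
  -- the symmetric certificate `L x = x 0 • 1 + x 2 • diag (s₁, s₂, s₃) + x 3 • b₀ c cᵀ`
  let L : (Fin 4 → ℝ) →ₗ[ℝ] Matrix (Fin 3) (Fin 3) ℝ := Fintype.linearCombination ℝ
    ![(1 : Matrix (Fin 3) (Fin 3) ℝ), 0, !![s₁, 0, 0; 0, s₂, 0; 0, 0, s₃],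
      b₀ • !![c₁ * c₁, c₁ * c₂, c₁ * c₃; c₁ * c₂, c₂ * c₂, c₂ * c₃; c₁ * c₃, c₂ * c₃, c₃ * c₃]]
  have hL : ∀ x : Fin 4 → ℝ, L x =
      !![x 0 + s₁ * x 2 + b₀ * (c₁ * c₁) * x 3, b₀ * (c₁ * c₂) * x 3, b₀ * (c₁ * c₃) * x 3;
        b₀ * (c₁ * c₂) * x 3, x 0 + s₂ * x 2 + b₀ * (c₂ * c₂) * x 3, b₀ * (c₂ * c₃) * x 3;
        b₀ * (c₁ * c₃) * x 3, b₀ * (c₂ * c₃) * x 3, x 0 + s₃ * x 2 + b₀ * (c₃ * c₃) * x 3] :=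
    fun x => permanentalCones_oshimeT_L_apply s₁ s₂ s₃ b₀ c₁ c₂ c₃ x
  have hLsymm : ∀ x : Fin 4 → ℝ, (L x).IsSymm := fun x =>
    (hL x).symm ▸ permanentalCones_oshimeT_L_isSymm s₁ s₂ s₃ b₀ c₁ c₂ c₃ x
  -- the determinantal identity `det (P x + τ·1) = det (L x + τ·1)` (F1, F3 and (L))
  have hdet : ∀ (x : Fin 4 → ℝ) (τ : ℝ), (P x + τ • (1 : Matrix (Fin 3) (Fin 3) ℝ)).det =
      (L x + τ • (1 : Matrix (Fin 3) (Fin 3) ℝ)).det := fun x τ => by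
    rw [hP, hL, permanentalCones_oshimeT_detP, permanentalCones_oshimeT_detL, hlag]
  -- stub S turns the identity into a size-`3` spectrahedral description
  have h := stub_spectrahedron_of_symmDetIdentity 4 3 P L hLsymm hdet
  simp only [hP] at h
  exact h

/-! ## The stub -/

/-- **Stub T≤ (Oshime's family (T), homogenised, coincident roots allowed, has size-`3`
spectrahedral cones).** For `s₁ ≤ s₂ ≤ s₃` and `s₁ ≤ b₁ ≤ s₂ ≤ b₂ ≤ s₃` (interlacing), the
closed nonnegative-spectrum cone `{x : ∀ τ > 0, det (x₀·1 + x₁ J₃ + x₂ B + x₃ C + τ·1) ≠ 0}` of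
the Jordan-block family (T) pencil of Oshime (1991, part (II), Prop. 4.6 / Thm. 6.2),
`B = !![0, e₂, −e₃; −1, e₁, 0; 0, 1, 0]`, `C = b₀ · !![0, b₁ + b₂, −b₁ b₂; 0, 1, 0; 0, 0, 0]`,
is a spectrahedron of size `3`. The strict case `s₁ < s₂ < s₃` is
`stub_oshimeFamilyTh_spectrahedron`; when roots coincide the interlacing pins the corresponding
`bⱼ`, and explicit nonnegative weights `κ` solve the Lagrange-type identity (L) of
`permanentalCones_oshimeTle_of_lagrange` with `cᵢ = √κᵢ`. [folklore] -/
theorem stub_oshimeFamilyTle_spectrahedron :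
    ∀ s₁ s₂ s₃ b₀ b₁ b₂ : ℝ, s₁ ≤ s₂ → s₂ ≤ s₃ → s₁ ≤ b₁ → b₁ ≤ s₂ → s₂ ≤ b₂ → b₂ ≤ s₃ →
      Literature.AlgebraicGeometry.HyperbolicPolynomials.IsSpectrahedralShadowOfSize
        {x : Fin 4 → ℝ | ∀ τ : ℝ, 0 < τ →
          (x 0 • (1 : Matrix (Fin 3) (Fin 3) ℝ) + x 1 • !![(0 : ℝ), 1, 0; 0, 0, 1; 0, 0, 0] +
            x 2 • !![0, s₁ * s₂ + s₂ * s₃ + s₃ * s₁, -(s₁ * s₂ * s₃); -1, s₁ + s₂ + s₃, 0; 0, 1, 0] +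
            x 3 • !![0, b₀ * (b₁ + b₂), -(b₀ * b₁ * b₂); 0, b₀, 0; 0, 0, 0] +
            τ • (1 : Matrix (Fin 3) (Fin 3) ℝ)).det ≠ 0} 3 := by
  intro s₁ s₂ s₃ b₀ b₁ b₂ h12 h23 hb1 hb1' hb2 hb2'
  rcases h12.lt_or_eq with h12 | h12 <;> rcases h23.lt_or_eq with h23 | h23
  · -- (i) distinct roots: the strict theorem
    exact stub_oshimeFamilyTh_spectrahedron s₁ s₂ s₃ b₀ b₁ b₂ h12 h23 hb1 hb1' hb2 hb2'
  · -- (iii) `s₁ < s₂ = s₃`, hence `b₂ = s₂`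
    have hb : b₂ = s₂ := le_antisymm (h23 ▸ hb2') hb2
    have h21 : s₂ - s₁ ≠ 0 := sub_ne_zero.2 h12.ne'
    obtain ⟨c₁, hc1⟩ : ∃ c : ℝ, c ^ 2 = (b₁ - s₁) / (s₂ - s₁) :=
      ⟨_, Real.sq_sqrt (div_nonneg (by linarith) (by linarith))⟩
    obtain ⟨c₂, hc2⟩ : ∃ c : ℝ, c ^ 2 = (s₂ - b₁) / (s₂ - s₁) :=
      ⟨_, Real.sq_sqrt (div_nonneg (by linarith) (by linarith))⟩
    refine permanentalCones_oshimeTle_of_lagrange s₁ s₂ s₃ b₀ b₁ b₂ c₁ c₂ 0 fun t y => ?_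
    rw [hc1, hc2]
    subst h23 hb
    field_simp
    ring
  · -- (ii) `s₁ = s₂ < s₃`, hence `b₁ = s₁`
    have hb : b₁ = s₁ := le_antisymm (h12 ▸ hb1') hb1
    have h31 : s₃ - s₁ ≠ 0 := sub_ne_zero.2 (h12 ▸ h23 : s₁ < s₃).ne'
    obtain ⟨c₁, hc1⟩ : ∃ c : ℝ, c ^ 2 = (b₂ - s₁) / (s₃ - s₁) :=
      ⟨_, Real.sq_sqrt (div_nonneg (by linarith) (by linarith))⟩
    obtain ⟨c₃, hc3⟩ : ∃ c : ℝ, c ^ 2 = (s₃ - b₂) / (s₃ - s₁) :=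
      ⟨_, Real.sq_sqrt (div_nonneg (by linarith) (by linarith))⟩
    refine permanentalCones_oshimeTle_of_lagrange s₁ s₂ s₃ b₀ b₁ b₂ c₁ 0 c₃ fun t y => ?_
    rw [hc1, hc3]
    subst h12 hb
    field_simp
    ring
  · -- (iv) `s₁ = s₂ = s₃`, hence `b₁ = b₂ = s₁`
    have hb : b₁ = s₁ := le_antisymm (h12 ▸ hb1') hb1
    have hb' : b₂ = s₂ := le_antisymm (h23 ▸ hb2') hb2
    refine permanentalCones_oshimeTle_of_lagrange s₁ s₂ s₃ b₀ b₁ b₂ 1 0 0 fun t y => ?_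
    subst h12 h23 hb hb'
    ring

end Summit.ValiantsHypothesis.ValiantsHypothesis.Theorems
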